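import Summits.QuantumFields.BalabanUV.T4Continuum.Support.BalabanAveragedTowerUnit

/-!
# T⁴ programme, spine node NE2 (U1a) — ZERO MODES of the `U = 1` tower of Bałaban's (1.18)-averaged free covariance:
# `c_k(J₀) = a⁻¹J₀` for EVERY `k` and for the LIMIT `c_∞` ([B5] (1.82) «GJ = GJ′ + a⁻¹J₀» along the tower), hence
# `a⁻¹ ≤ ‖c_∞‖`: the limit of `Support/BalabanAveragedTowerUnit.unitCovB_tendsto` is NONDEGENERATE

Eighth generation of the NE2 prover lineage P1 of the cell `pub-balaban`, file 4 (companion of files 2–3).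

 * §1 (one torus): the own-direction translations, the straight-contour average `Lavg` and its adjoint FIX the `x`-constant
   vector fields `(x, μ) ↦ c_μ` (`constV`);
 * §2 (two levels `N ← R·N`): King's block average maps fine constants to coarse constants (`Qavg_mulVec_constV`) and its
   ADJOINT spreads a coarse constant to `R^{−d}`·(fine constant) (`Qavg_conjTranspose_mulVec_constV` — every fine site has
   exactly one `R`-block parent: the block decomposition `x = R·par(x) + rem(x)`, `cpt_par_add_off_rem`, `par_cpt_add_off`,
   `rem_cpt_add_off`, [King1986] (2.10) / [B5] (1.6)); hence the same for Bałaban's `QB = Qavg ∘ Lavg`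
   (`QB_mulVec_constV`, `QB_conjTranspose_mulVec_constV`);
 * §3 (the tower of file 3): `Atow QBlev k` fixes constants, its adjoint spreads them with the factor `(L^d)^{−k}`,
   `𝒢^{(L^{−k})}` multiplies them by `a⁻¹` (the lineage's `B5G183RateUnitTower.calG_mulVec_const` = [B5] (1.82) at `U = 1`),
   so **`unitCovB_mulVec_constV`**: `c_k(J₀) = a⁻¹J₀` for every `k`; by continuity (`CovariantAveragingTower.
   limit_mulVec_of_forall`) **`limit_mulVec_constV`**: `c_∞(J₀) = a⁻¹J₀`; **`inv_le_opNorm_unitCovB`**, **`inv_le_opNorm_limit`**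
   (`a⁻¹ ≤ ‖c_k‖, ‖c_∞‖`, `d ≥ 1`) and the uniform bound **`opNorm_unitCovB_le`** (`‖c_k‖ ≤ Cst(d,a)`, (1.89)).

HONEST FRAMING (T4-DAG p. 1).  `U = 1`, FIXED FINITE torus, linear layer; statements OURS ([folklore]) about the cell's own
tower object; the `[B5]`/`[King1986]` locators document the printed objects typed ((1.18), (1.82), (2.10)).  Not the η-rate
itself (files 2–3), not `U ≠ 1` (open row G-an2-4, typed in `Spine/CovariantAveragingTower`), NOT infinite volume, NOT a mass
gap, NOT Clay, NOT summit progress.  HONEST DEPENDENCY: continuum YM on T⁴ ⇐ BetaPertH ∧ nine spine estimates (0/9 proved);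
BetaPertH ⇐ (D1) ∧ (D4) ∧ CAP+tail; G-an2-4 gates asym, D1 and NE2/3/4.  ABSOLUTE RULE kept; no `sorry`.
-/

noncomputable section

open scoped BigOperators ComplexConjugate Matrix Matrix.Norms.L2Operator
open Filter Topology Finset

namespace Summit.QuantumFields.BalabanUV.T4Continuum.BalabanAveragedTowerModes

open Literature.MathematicalPhysics.QuantumFieldTheory.Balaban1983to89.B5Prop11Plancherel
open Literature.MathematicalPhysics.QuantumFieldTheory.Balaban1983to89.B5Prop11Lower (nsq nsq_mulVec_le)
open Literature.MathematicalPhysics.QuantumFieldTheory.Balaban1983to89.B5Block118 (tstep)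
open Literature.MathematicalPhysics.QuantumFieldTheory.Balaban1983to89.B5G183RateTorus (cpt)
open Literature.MathematicalPhysics.QuantumFieldTheory.Balaban1983to89.B5G183RateTorusW
open Literature.MathematicalPhysics.QuantumFieldTheory.Balaban1983to89.B5G183RateUnitTower (lev lev_neZero calG_mulVec_const)
open Summit.QuantumFields.BalabanUV.T4Continuum.CovariantAveragingTower
open Summit.QuantumFields.BalabanUV.T4Continuum.BalabanLineAverage
open Summit.QuantumFields.BalabanUV.T4Continuum.BalabanAveragedTowerUnit

variable {d : ℕ}

/-! ## §1 Constants are fixed by the translations and by the straight-contour average -/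

section OneLevel

variable (Nf : Fin d → ℕ) [hNf : ∀ μ, NeZero (Nf μ)]

omit hNf in
/-- the `x`-CONSTANT vector field `(x, μ) ↦ c_μ` («J₀ constant» of [B5] p. 31). [folklore] -/
def constV (c : Fin d → ℂ) : Tor Nf × Fin d → ℂ := fun i => c i.2

/-- `S_t J₀ = J₀`. [folklore] -/
theorem shiftT_mulVec_constV (t : ℕ) (c : Fin d → ℂ) : shiftT Nf t *ᵥ constV Nf c = constV Nf c := by
  funext i
  simp only [Matrix.mulVec, dotProduct, shiftT, constV, ite_mul, one_mul, zero_mul, Finset.sum_ite_eq',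
    Finset.mem_univ, if_true]

/-- `S_tᴴ J₀ = J₀`. [folklore] -/
theorem shiftT_conjTranspose_mulVec_constV (t : ℕ) (c : Fin d → ℂ) :
    (shiftT Nf t)ᴴ *ᵥ constV Nf c = constV Nf c := by
  funext j
  simp only [Matrix.mulVec, dotProduct, Matrix.conjTranspose_apply, shiftT, constV, apply_ite star, star_one,
    star_zero, ite_mul, one_mul, zero_mul]
  simp_rw [shiftT_eq_iff Nf t _ j]
  rw [Finset.sum_ite_eq' Finset.univ (j.1 - tstep Nf j.2 t, j.2)]
  simp

variable (R : ℕ) [NeZero R]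

/-- `Lavg J₀ = J₀`. [folklore] -/
theorem Lavg_mulVec_constV (c : Fin d → ℂ) : Lavg Nf R *ᵥ constV Nf c = constV Nf c := by
  have hR : (R : ℂ) ≠ 0 := by exact_mod_cast NeZero.ne R
  rw [Lavg, Matrix.smul_mulVec, Matrix.sum_mulVec]
  simp_rw [shiftT_mulVec_constV]
  rw [Finset.sum_const, Finset.card_univ, Fintype.card_fin, ← Nat.cast_smul_eq_nsmul ℂ, smul_smul,
    inv_mul_cancel₀ hR, one_smul]

/-- `Lavgᴴ J₀ = J₀`. [folklore] -/
theorem Lavg_conjTranspose_mulVec_constV (c : Fin d → ℂ) : (Lavg Nf R)ᴴ *ᵥ constV Nf c = constV Nf c := by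
  have hR : (R : ℂ) ≠ 0 := by exact_mod_cast NeZero.ne R
  have hs : star ((R : ℂ))⁻¹ = ((R : ℂ))⁻¹ := by simp
  rw [Lavg, Matrix.conjTranspose_smul, Matrix.conjTranspose_sum, hs, Matrix.smul_mulVec, Matrix.sum_mulVec]
  simp_rw [shiftT_conjTranspose_mulVec_constV]
  rw [Finset.sum_const, Finset.card_univ, Fintype.card_fin, ← Nat.cast_smul_eq_nsmul ℂ, smul_smul,
    inv_mul_cancel₀ hR, one_smul]

end OneLevel

/-! ## §2 Two levels: block parents, King's `Q` and Bałaban's `QB` on constants -/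

section TwoLevel

variable (N R : ℕ) [NeZero N] [NeZero R] (M : Fin d → ℕ) [hM : ∀ μ, NeZero (M μ)]

/-- `Q J₀′ = J₀` (block means of a fine constant field are the coarse constant field). [cite: King1986, (2.10) p.653]
[folklore] -/
theorem Qavg_mulVec_constV (c : Fin d → ℂ) : Qavg N R M *ᵥ constV (fine (R * N) M) c = constV (fine N M) c := by
  have hR : ((R : ℂ) ^ d) ≠ 0 := pow_ne_zero _ (by exact_mod_cast NeZero.ne R)
  funext i
  set X : Matrix (Tor (fine (R * N) M) × Fin d) Unit ℂ := Matrix.of fun x _ => constV (fine (R * N) M) c x with hX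
  have e : (Qavg N R M *ᵥ constV (fine (R * N) M) c) i = (Qavg N R M * X) i () := rfl
  rw [e, Qavg_mul_apply]
  simp only [hX, Matrix.of_apply]
  simp only [constV, Finset.sum_const, Finset.card_univ, Fintype.card_fun, Fintype.card_fin, nsmul_eq_mul]
  push_cast
  rw [← mul_assoc, inv_mul_cancel₀ hR, one_mul]

/-- the BLOCK PARENT of a fine site: `par(x)_ν = ⌊x_ν / R⌋`. [cite: King1986, (2.10) p.653 («B^k(y)»)] [folklore] -/
def par (x : Tor (fine (R * N) M)) : Tor (fine N M) := fun ν => (((x ν).val / R : ℕ) : ZMod (fine N M ν))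

/-- the OFFSET of a fine site in its block: `rem(x)_ν = x_ν mod R`. [folklore] -/
def rem (x : Tor (fine (R * N) M)) : Fin d → Fin R :=
  fun ν => ⟨(x ν).val % R, Nat.mod_lt _ (Nat.pos_of_ne_zero (NeZero.ne R))⟩

/-- `par(x)_ν` has value `⌊x_ν / R⌋`. [folklore] -/
theorem val_par (x : Tor (fine (R * N) M)) (ν : Fin d) : (par N R M x ν).val = (x ν).val / R := by
  have hR : 0 < R := Nat.pos_of_ne_zero (NeZero.ne R)
  have hx : (x ν).val < R * N * M ν := ZMod.val_lt (x ν)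
  unfold par
  rw [ZMod.val_cast_of_lt]
  show (x ν).val / R < N * M ν
  rw [Nat.div_lt_iff_lt_mul hR]
  calc (x ν).val < R * N * M ν := hx
    _ = N * M ν * R := by ring

/-- **block decomposition** `x = R·par(x) + rem(x)`. [cite: King1986, (2.10) p.653] [folklore] -/
theorem cpt_par_add_off_rem (x : Tor (fine (R * N) M)) : cpt N R M (par N R M x) + off N R M (rem N R M x) = x := by
  funext ν
  simp only [Pi.add_apply, cpt, off, rem, val_par]
  rw [← Nat.cast_add, Nat.div_add_mod, ZMod.natCast_zmod_val]

omit [NeZero R] in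
/-- the value of `(R·y + j)_ν` is `R·y_ν + j_ν` (no wrap-around). [folklore] -/
theorem val_cpt_add_off (y : Tor (fine N M)) (j : Fin d → Fin R) (ν : Fin d) :
    ((cpt N R M y + off N R M j) ν).val = R * (y ν).val + (j ν : ℕ) := by
  have hy : (y ν).val < N * M ν := ZMod.val_lt (y ν)
  have hj : (j ν : ℕ) < R := (j ν).isLt
  have hlt : R * (y ν).val + (j ν : ℕ) < fine (R * N) M ν := by
    calc R * (y ν).val + (j ν : ℕ) < R * (y ν).val + R := by omega
      _ = R * ((y ν).val + 1) := by ring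
      _ ≤ R * (N * M ν) := Nat.mul_le_mul_left _ hy
      _ = fine (R * N) M ν := by simp only [fine]; ring
  simp only [Pi.add_apply, cpt, off]
  rw [← Nat.cast_add, ZMod.val_cast_of_lt hlt]

/-- uniqueness of the parent: `par(R·y + j) = y`. [folklore] -/
theorem par_cpt_add_off (y : Tor (fine N M)) (j : Fin d → Fin R) : par N R M (cpt N R M y + off N R M j) = y := by
  have hR : 0 < R := Nat.pos_of_ne_zero (NeZero.ne R)
  funext ν
  apply ZMod.val_injective
  rw [val_par, val_cpt_add_off, Nat.mul_add_div hR, Nat.div_eq_of_lt (j ν).isLt, add_zero]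

/-- uniqueness of the offset: `rem(R·y + j) = j`. [folklore] -/
theorem rem_cpt_add_off (y : Tor (fine N M)) (j : Fin d → Fin R) : rem N R M (cpt N R M y + off N R M j) = j := by
  funext ν
  apply Fin.ext
  simp only [rem, val_cpt_add_off, Nat.mul_add_mod, Nat.mod_eq_of_lt (j ν).isLt]

/-- `x = (R·y + j, μ)` pins down `y = par x`, `j = rem x`, `μ`. [folklore] -/
theorem eq_par_rem_of_eq {x : Tor (fine (R * N) M) × Fin d} {i : Tor (fine N M) × Fin d} {j : Fin d → Fin R}
    (h : x = (cpt N R M i.1 + off N R M j, i.2)) : i = (par N R M x.1, x.2) ∧ j = rem N R M x.1 := by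
  have h1 : x.1 = cpt N R M i.1 + off N R M j := by rw [h]
  have h2 : x.2 = i.2 := by rw [h]
  refine ⟨Prod.ext ?_ h2.symm, ?_⟩
  · show i.1 = par N R M x.1
    rw [h1, par_cpt_add_off]
  · rw [h1, rem_cpt_add_off]

omit [NeZero N] [NeZero R] hM in
/-- the entries of `Q` are real. [folklore] -/
theorem star_Qavg_apply (i : Tor (fine N M) × Fin d) (x : Tor (fine (R * N) M) × Fin d) :
    star (Qavg N R M i x) = Qavg N R M i x := by
  simp only [Qavg, star_mul', star_inv₀, star_pow, star_natCast, star_sum, apply_ite star, star_one, star_zero]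

/-- **`Qᴴ J₀ = R^{−d}·J₀′`**: the adjoint block averaging spreads a coarse constant field to `R^{−d}` times the fine
constant field — every fine site has EXACTLY ONE block parent. [cite: King1986, (2.10) p.653] [folklore] -/
theorem Qavg_conjTranspose_mulVec_constV (c : Fin d → ℂ) :
    (Qavg N R M)ᴴ *ᵥ constV (fine N M) c = ((R : ℂ) ^ d)⁻¹ • constV (fine (R * N) M) c := by
  funext x
  rw [Pi.smul_apply, smul_eq_mul, Matrix.mulVec, dotProduct]
  simp_rw [Matrix.conjTranspose_apply, star_Qavg_apply]
  simp only [Qavg, constV]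
  rw [Finset.sum_eq_single (par N R M x.1, x.2)]
  · rw [Finset.sum_eq_single (rem N R M x.1)]
    · rw [if_pos]
      · ring
      · exact Prod.ext (cpt_par_add_off_rem N R M x.1).symm rfl
    · intro j _ hj
      rw [if_neg]
      intro h
      exact hj (eq_par_rem_of_eq N R M h).2
    · intro h; exact absurd (Finset.mem_univ _) h
  · intro i _ hi
    have h0 : ∀ j : Fin d → Fin R, ¬ x = (cpt N R M i.1 + off N R M j, i.2) := fun j h => hi (eq_par_rem_of_eq N R M h).1
    simp_rw [if_neg (h0 _)]
    simp
  · intro h; exact absurd (Finset.mem_univ _) h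

/-- **`QB J₀′ = J₀`**: Bałaban's averaging fixes constants. [cite: Balaban1984PropagatorsI, (1.18) p.20, (1.74) p.30]
[folklore] -/
theorem QB_mulVec_constV (c : Fin d → ℂ) : QB N R M *ᵥ constV (fine (R * N) M) c = constV (fine N M) c := by
  rw [QB, ← Matrix.mulVec_mulVec, Lavg_mulVec_constV, Qavg_mulVec_constV]

/-- **`QBᴴ J₀ = R^{−d}·J₀′`**. [cite: Balaban1984PropagatorsI, (1.18) p.20] [folklore] -/
theorem QB_conjTranspose_mulVec_constV (c : Fin d → ℂ) :
    (QB N R M)ᴴ *ᵥ constV (fine N M) c = ((R : ℂ) ^ d)⁻¹ • constV (fine (R * N) M) c := by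
  rw [QB, Matrix.conjTranspose_mul, ← Matrix.mulVec_mulVec, Qavg_conjTranspose_mulVec_constV, Matrix.mulVec_smul,
    Lavg_conjTranspose_mulVec_constV]

end TwoLevel

/-! ## §3 The tower: `c_k(J₀) = a⁻¹J₀` for every `k` and for the limit; nondegeneracy -/

section Tower

variable (L : ℕ) [NeZero L] (M : Fin d → ℕ) [hM : ∀ μ, NeZero (M μ)]

/-- the constant field on the level-`k` index set. [folklore] -/
abbrev cst (k : ℕ) (c : Fin d → ℂ) : idx L M k → ℂ := constV (fine (lev L k) M) c

/-- the composite averaging fixes constants: `QBtow_k J₀^{(k)} = J₀^{(0)}`. [folklore] -/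
theorem Atow_mulVec_cst (k : ℕ) (c : Fin d → ℂ) : Atow (QBlev L M) k *ᵥ cst L M k c = cst L M 0 c := by
  induction k with
  | zero => rw [Atow_zero, Matrix.one_mulVec]
  | succ k ih =>
    have h1 : QBlev L M k *ᵥ cst L M (k + 1) c = cst L M k c := QB_mulVec_constV (lev L k) L M c
    rw [Atow_succ, ← Matrix.mulVec_mulVec, h1, ih]

/-- its adjoint spreads them: `QBtow_kᴴ J₀^{(0)} = (L^d)^{−k}·J₀^{(k)}`. [folklore] -/
theorem Atow_conjTranspose_mulVec_cst (k : ℕ) (c : Fin d → ℂ) :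
    (Atow (QBlev L M) k)ᴴ *ᵥ cst L M 0 c = (((L : ℂ) ^ d) ^ k)⁻¹ • cst L M k c := by
  induction k with
  | zero => rw [Atow_zero, Matrix.conjTranspose_one, Matrix.one_mulVec, pow_zero, inv_one, one_smul]
  | succ k ih =>
    have h1 : (QBlev L M k)ᴴ *ᵥ cst L M k c = ((L : ℂ) ^ d)⁻¹ • cst L M (k + 1) c :=
      QB_conjTranspose_mulVec_constV (lev L k) L M c
    rw [Atow_succ, Matrix.conjTranspose_mul, ← Matrix.mulVec_mulVec, ih, Matrix.mulVec_smul, h1, smul_smul,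
      pow_succ, mul_inv]

variable (a : ℝ) (ha : 0 < a)

/-- **`c_k(J₀) = a⁻¹J₀` for every `k`**: Bałaban's (1.82) «GJ = GJ′ + a⁻¹J₀» survives the (1.18)-averaging tower
(`QBtow_kᴴ` spreads `J₀` with `(L^d)^{−k}`, `𝒢^{(L^{−k})}` multiplies by `a⁻¹`, `QBtow_k` averages back, the normalisation
`(L^d)^k` cancels). [cite: Balaban1984PropagatorsI, (1.82) p.31, (1.18) p.20] — statement ours. [folklore] -/
theorem unitCovB_mulVec_cst (k : ℕ) (c : Fin d → ℂ) :
    unitCovB L M a ha k *ᵥ cst L M 0 c = ((a : ℂ))⁻¹ • cst L M 0 c := by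
  have hr : (((L : ℂ) ^ d) ^ k) ≠ 0 := pow_ne_zero _ (pow_ne_zero _ (by exact_mod_cast NeZero.ne L))
  have hG : calGlev L M a ha k *ᵥ cst L M k c = ((a : ℂ))⁻¹ • cst L M k c :=
    calG_mulVec_const M a ha (lev L k) (one_le_lev' L k) c
  have e : unitCovB L M a ha k
      = (((L : ℂ) ^ d) ^ k) • (Atow (QBlev L M) k * calGlev L M a ha k * (Atow (QBlev L M) k)ᴴ) := by
    unfold unitCovB avgTow
    push_cast
    rfl
  rw [e, Matrix.smul_mulVec, ← Matrix.mulVec_mulVec, ← Matrix.mulVec_mulVec, Atow_conjTranspose_mulVec_cst,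
    Matrix.mulVec_smul, hG, Matrix.mulVec_smul, Matrix.mulVec_smul, Atow_mulVec_cst, smul_smul, smul_smul,
    mul_inv_cancel₀ hr, one_mul]

/-- **the limit has the same zero modes: `c_∞(J₀) = a⁻¹J₀`** (`L ≥ 2`; continuity, `limit_mulVec_of_forall`). [cite:
Balaban1984PropagatorsI, (1.82) p.31] — statement ours. [folklore] -/
theorem limit_mulVec_cst {cinf : Matrix (idx L M 0) (idx L M 0) ℂ}
    (hlim : Tendsto (unitCovB L M a ha) atTop (𝓝 cinf)) (c : Fin d → ℂ) :
    cinf *ᵥ cst L M 0 c = ((a : ℂ))⁻¹ • cst L M 0 c :=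
  limit_mulVec_of_forall (A := QBlev L M) (r := (L : ℝ) ^ d) (X := calGlev L M a ha) hlim (cst L M 0 c)
    (((a : ℂ))⁻¹ • cst L M 0 c) (fun k => unitCovB_mulVec_cst L M a ha k c)

omit [NeZero L] hM in
/-- an eigenvalue is bounded by the operator norm: `A v = μ v`, `v ≠ 0` ⇒ `|μ| ≤ ‖A‖`. [folklore] -/
theorem norm_eigen_le_opNorm {m : Type*} [Fintype m] [DecidableEq m] (A : Matrix m m ℂ) {v : m → ℂ} (hv : v ≠ 0)
    {μ : ℂ} (h : A *ᵥ v = μ • v) : ‖μ‖ ≤ ‖A‖ := by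
  have h1 := nsq_mulVec_le A v
  rw [h] at h1
  have hnsq : nsq (μ • v) = ‖μ‖ ^ 2 * nsq v := by
    simp only [nsq, Pi.smul_apply, smul_eq_mul, norm_mul, mul_pow, Finset.mul_sum]
  rw [hnsq] at h1
  have hpos : 0 < nsq v := by
    obtain ⟨i, hi⟩ := Function.ne_iff.mp hv
    have hle : ‖v i‖ ^ 2 ≤ nsq v :=
      Finset.single_le_sum (f := fun i => ‖v i‖ ^ 2) (fun i _ => sq_nonneg _) (Finset.mem_univ i)
    have hvi : 0 < ‖v i‖ ^ 2 := by
      have : 0 < ‖v i‖ := norm_pos_iff.mpr hi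
      positivity
    linarith
  have h2 : ‖μ‖ ^ 2 ≤ ‖A‖ ^ 2 := le_of_mul_le_mul_right h1 hpos
  exact (pow_le_pow_iff_left₀ (norm_nonneg _) (norm_nonneg _) two_ne_zero).mp h2

omit [NeZero L] hM in
/-- a nonzero constant field exists as soon as `d ≥ 1`. [folklore] -/
theorem cst_ne_zero (hd : 0 < d) (k : ℕ) [NeZero (lev L k)] :
    cst L M k (fun _ => (1 : ℂ)) ≠ 0 := by
  intro h
  have h1 := congr_fun h ((0 : Tor (fine (lev L k) M)), ⟨0, hd⟩)
  simp [constV] at h1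

/-- **`a⁻¹ ≤ ‖c_k‖`** (`d ≥ 1`). [cite: Balaban1984PropagatorsI, (1.82) p.31] — statement ours. [folklore] -/
theorem inv_le_opNorm_unitCovB (hd : 0 < d) (k : ℕ) : a⁻¹ ≤ ‖unitCovB L M a ha k‖ := by
  have h := norm_eigen_le_opNorm (unitCovB L M a ha k) (cst_ne_zero L M hd 0) (unitCovB_mulVec_cst L M a ha k _)
  rwa [norm_inv, Complex.norm_real, Real.norm_of_nonneg ha.le] at h

/-- **`a⁻¹ ≤ ‖c_∞‖`**: the limit of the (1.18)-averaged unit-lattice free covariance is NONDEGENERATE (`d ≥ 1`). [cite: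
Balaban1984PropagatorsI, (1.82) p.31] — statement ours. [folklore] -/
theorem inv_le_opNorm_limit (hd : 0 < d) {cinf : Matrix (idx L M 0) (idx L M 0) ℂ}
    (hlim : Tendsto (unitCovB L M a ha) atTop (𝓝 cinf)) : a⁻¹ ≤ ‖cinf‖ := by
  have h := norm_eigen_le_opNorm cinf (cst_ne_zero L M hd 0) (limit_mulVec_cst L M a ha hlim _)
  rwa [norm_inv, Complex.norm_real, Real.norm_of_nonneg ha.le] at h

/-- **`‖c_k‖ ≤ Cst(d,a)`** uniformly in `k` (`‖QBtow_k‖² ≤ (L^d)^{−k}` and the printed uniform bound `‖𝒢‖ ≤ Cst` (1.89)).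
[cite: Balaban1984PropagatorsI, Prop. 1.1 (1.89) p.33] [folklore] -/
theorem opNorm_unitCovB_le (k : ℕ) : ‖unitCovB L M a ha k‖ ≤ Cst d a := by
  have hL : (0 : ℝ) < (L : ℝ) ^ d := pow_pos (by exact_mod_cast Nat.pos_of_ne_zero (NeZero.ne L)) d
  have hrk : (0 : ℝ) < ((L : ℝ) ^ d) ^ k := pow_pos hL k
  have hA := opNorm_Atow_sq_le (QBlev L M) hL (opNorm_QBlev_sq_le L M) k
  have hG : ‖calGlev L M a ha k‖ ≤ Cst d a := opNorm_calG_le (lev L k) (one_le_lev' L k) M a ha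
  have e : unitCovB L M a ha k
      = ((((L : ℝ) ^ d) ^ k : ℝ) : ℂ) • (Atow (QBlev L M) k * calGlev L M a ha k * (Atow (QBlev L M) k)ᴴ) := by
    unfold unitCovB avgTow
    push_cast
    rfl
  rw [e, norm_smul, Complex.norm_real, Real.norm_of_nonneg hrk.le]
  calc ((L : ℝ) ^ d) ^ k * ‖Atow (QBlev L M) k * calGlev L M a ha k * (Atow (QBlev L M) k)ᴴ‖
      ≤ ((L : ℝ) ^ d) ^ k * (‖Atow (QBlev L M) k‖ * ‖calGlev L M a ha k‖ * ‖Atow (QBlev L M) k‖) := by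
        refine mul_le_mul_of_nonneg_left ?_ hrk.le
        calc _ ≤ ‖Atow (QBlev L M) k * calGlev L M a ha k‖ * ‖(Atow (QBlev L M) k)ᴴ‖ := Matrix.l2_opNorm_mul _ _
          _ ≤ ‖Atow (QBlev L M) k‖ * ‖calGlev L M a ha k‖ * ‖Atow (QBlev L M) k‖ := by
              rw [Matrix.l2_opNorm_conjTranspose]
              exact mul_le_mul_of_nonneg_right (Matrix.l2_opNorm_mul _ _) (norm_nonneg _)
    _ = ((L : ℝ) ^ d) ^ k * ‖Atow (QBlev L M) k‖ ^ 2 * ‖calGlev L M a ha k‖ := by ring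
    _ ≤ ((L : ℝ) ^ d) ^ k * (((L : ℝ) ^ d) ^ k)⁻¹ * Cst d a := by
        have hC := Cst_nonneg d a
        gcongr
    _ = Cst d a := by rw [mul_inv_cancel₀ hrk.ne', one_mul]

end Tower

end Summit.QuantumFields.BalabanUV.T4Continuum.BalabanAveragedTowerModes

end
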